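import Summits.BirchSwinnertonDyer.BirchSwinnertonDyer.Theses.KatoDescentPotSupersingular
import Summits.BirchSwinnertonDyer.Rank1Residual.Additive.N11KimAtThreePUB
import Summits.BirchSwinnertonDyer.Rank1Residual.Additive.PotSupersingularClasses
import HarnessLib

/-!
# Route `KatoDescentPotSupersingular` (rung K9, cell `bsd-potss`): the crux `WildLowerHalfRankZero`
# (L₀, item stmt-BirchSwinnertonDyer-19195) — the KIM–KURIHARA ROAD on the tower-surjective wild rows
# (a `--supports` file; companion of `KatoDescentPotSupersingularWildLowerHalfRankZero.lean`)

The companion file records two conditional roads to the crux's irreducible rows — Kato's Main Conjecture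
at `3` (interface `KMC`, D-O6-2; all rows; open problem) and the Fouquet–Wan claim (X4 ∧ LocIrr ∧
FWNonsplitRam; PRE) — and the Cassels reductions. This file records the THIRD road, which runs through a
DIFFERENT rung of the ladder: rung W2's leaf `N11.KimAtThreeRankZeroPUB` (route `KimAtThreeKolyvagin`,
items 19075–19077; Kim arXiv:2505.09121 Thm. 1.1/1.2 at `p = 3`, rank `0`, `E(ℚ₃)[3] = 0`: for the
`3`-adic tower onto, `∂^{(0)}(δ̃) = ord₃ #Ш(3) + ∂^{(∞)}(δ̃)` — Kim's Kurihara-number formula, with NO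
hypothesis on the reduction type at `3`, so the WILD additive rows of `ClassO6` are inside its scope).
Granted that leaf, ONE Kurihara number per pair settles L₀ there: a UNIT `δ̃_n` on the `3 ∤ ∏ c_ℓ` rows
(then `∂^{(∞)} = 0` and `BSD₃` holds outright — tree consumer
`N11.bsdp_three_of_kimAtThreeRankZeroPUB_of_kuriharaUnitAt`), or a level-`k` `δ̃_n^{(k)} ≠ 0` with
`k − 1 ≤ v₃(∏ c_ℓ)` on the others (`N11.missingLowerBoundAt_three_of_kimAtThreeRankZeroPUB_of_indexCert`).
Per pair this is a finite modular-symbol certificate; CLASS-WIDE the existence of such Kurihara numbers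
is Kurihara's conjecture, equivalent to Kato's IMC by Kim's Conj. 1.3 (`X4.KuriharaUnitAt` docstring) —
so this road does not lower the class-wide difficulty of the item, it changes its per-pair
checkability (cheap modular symbols instead of a `3`-descent) and ties the tower-surjective `t = 0`
wild rows of `stub_lower_irred` to rung W2. Every conjectural input is displayed (`hKim` = the W2 leaf,
an `@[conjecture]` node with a refereed cell memo, NOT a Literature fact; `hKu` / `hδ` = per-pair
certificates; `hKur` = Kurihara's conjecture on the rows); GZK, modularity and the period-transfer
binder (discharged on an optimal datum with `3 ∤ c_D` by `X4.periodTransfer_of_optimal`) are the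
published inputs. Conditional; the item is NOT closed. Seat `bsd-potss-k9-c2` (prover), generation 0.

References: [Kim2025RefinedTNC] Thm. 1.1/1.2 (PDF pp. 5–6); [Kim2022StructureSelmer] Thm. 1.9 (1),(6),
Conj. 1.3, §1.5.1; [Kurihara2014] §1; [Miller2011LMS] Def. 1.1; [Darmon2004] Thm. 3.22 (GZK).
-/

set_option autoImplicit false
-- sibling precedent (`KatoDescentPotSupersingularAssembly.lean`): the directory name repeats the summit name
set_option linter.dupNamespace false

noncomputable section

open scoped Classical

namespace Summit.BirchSwinnertonDyer.BirchSwinnertonDyer.Theorems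

open WeierstrassCurve Literature.NumberTheory.EllipticCurves
  Literature.NumberTheory.EllipticCurves.ModularForms
  Literature.NumberTheory.EllipticCurves.Rank1Residual
  Literature.NumberTheory.EllipticCurves.Rank1Residual.Typed
  Summit.BirchSwinnertonDyer.Rank1Residual.Additive
  Summit.BirchSwinnertonDyer.Rank1Residual
  Summit.BirchSwinnertonDyer.BirchSwinnertonDyer.Theses.KatoDescentPotSupersingular

/-! ## The Kim–Kurihara road on the tower-surjective rows: rung W2's leaf + one Kurihara number per pair -/

section KimKurihara

/-- **`BSD₃`'s `p`-part on a tower-surjective wild rank-`0` row with `E(ℚ₃)[3] = 0`, from rung W2's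
leaf + ONE unit Kurihara number** (GZK, modularity, the period-transfer binder `hper` — discharged on an
optimal datum with `3 ∤ c_D` by `X4.periodTransfer_of_optimal` —, `3 ∤ ∏_ℓ c_ℓ`): the tree's
`N11.bsdp_three_of_kimAtThreeRankZeroPUB_of_kuriharaUnitAt` (Kim's formula `∂^{(0)}(δ̃) = ord₃ #Ш(3) +
∂^{(∞)}(δ̃)`; a unit forces `∂^{(∞)} = 0`) in Miller's currency. The leaf `N11.KimAtThreeRankZeroPUB`
carries NO reduction-type hypothesis at `3` (Kim 2025 Thm. 1.1: "independent of … the local behaviour of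
`f` at `p`"), so the WILD rows are inside; `hKim` is the W2 route's target (an `@[conjecture]` node with
a refereed cell memo, NOT a Literature fact) and `hKu` a per-pair certificate (class-wide: Kurihara's
conjecture, equivalent to Kato's IMC by Kim's Conj. 1.3). Conditional; nothing credited.
[cite: Kim2025RefinedTNC, Thm. 1.1 and Thm. 1.2 (PDF pp. 5–6)] [cite: Kim2022StructureSelmer, Thm. 1.9 (1) and (6), Conj. 1.3]
[cite: Miller2011LMS, Def. 1.1] -/
theorem missingPPartAt_wild_of_kimAtThree_of_kuriharaUnitAt (hKim : N11.KimAtThreeRankZeroPUB)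
    (hGZK : rank_eq_analyticRank_of_analyticRank_le_one) (hmod : hasEntireLFunction_rat)
    (W : WeierstrassCurve ℚ) [W.IsElliptic] [W.IsGloballyMinimal] [Fact (3 : ℕ).Prime]
    (hr : W.analyticRank = 0) (_hO : ClassO6 W 3)
    (htower : ∀ n : ℕ, W.HasSurjectiveModNGaloisRep (3 ^ n : ℕ))
    (ht0 : Nat.card {Q : (W.baseChange ℚ_[3]).toAffine.Point // (3 : ℕ) • Q = 0} = 1)
    {N : ℕ} [NeZero N] (D : ModularParametrizationData W N)
    (hper : ∃ u : ℚ, ‖(u : ℚ_[3])‖ = 1 ∧ W.realPeriodRat = u * plusPeriod D.f)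
    (htam : ¬ 3 ∣ W.tamagawaProduct) (hKu : X4.KuriharaUnitAt W 3 D.f) : MissingPPartAt W 3 := by
  haveI : Finite W.sha := (hGZK W (by rw [hr]; exact zero_le_one)).2
  exact missingPPartAt_of_bsdp W 3 (N11.bsdp_three_of_kimAtThreeRankZeroPUB_of_kuriharaUnitAt W hKim
    hGZK htower ht0 ((W.analyticRank_eq_zero_iff_holds (hmod W)).mp hr) D hper htam hKu)

/-- **L₀ on the same rows** (the lower half of the previous theorem).
[cite: Kim2025RefinedTNC, Thm. 1.2 (rk 0)] [cite: Miller2011LMS, Def. 1.1] -/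
theorem missingLowerBoundAt_wild_of_kimAtThree_of_kuriharaUnitAt (hKim : N11.KimAtThreeRankZeroPUB)
    (hGZK : rank_eq_analyticRank_of_analyticRank_le_one) (hmod : hasEntireLFunction_rat)
    (W : WeierstrassCurve ℚ) [W.IsElliptic] [W.IsGloballyMinimal] [Fact (3 : ℕ).Prime]
    (hr : W.analyticRank = 0) (hO : ClassO6 W 3)
    (htower : ∀ n : ℕ, W.HasSurjectiveModNGaloisRep (3 ^ n : ℕ))
    (ht0 : Nat.card {Q : (W.baseChange ℚ_[3]).toAffine.Point // (3 : ℕ) • Q = 0} = 1)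
    {N : ℕ} [NeZero N] (D : ModularParametrizationData W N)
    (hper : ∃ u : ℚ, ‖(u : ℚ_[3])‖ = 1 ∧ W.realPeriodRat = u * plusPeriod D.f)
    (htam : ¬ 3 ∣ W.tamagawaProduct) (hKu : X4.KuriharaUnitAt W 3 D.f) : MissingLowerBoundAt W 3 :=
  (lower_and_upper_of_missingPPartAt W 3 (missingPPartAt_wild_of_kimAtThree_of_kuriharaUnitAt hKim
    hGZK hmod W hr hO htower ht0 D hper htam hKu)).1

/-- **L₀ on a tower-surjective wild rank-`0` row with `E(ℚ₃)[3] = 0` and `3 ∣ ∏ c_ℓ` allowed, from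
rung W2's leaf + ONE level-`k` Kurihara number `δ̃_n^{(k)} ≠ 0` with `k − 1 ≤ v₃(∏ c_ℓ)`** (an optimal
datum with `3 ∤ c_D`, GZK, modularity): the tree's
`N11.missingLowerBoundAt_three_of_kimAtThreeRankZeroPUB_of_indexCert` (Kim's index certificate:
`∂^{(∞)} ≤ ord₃ δ̃_n^{(k)}`-type bound ⟹ `ord₃ #Ш_an ≤ ord₃ #Ш`). Per-pair certificate; conditional on
the W2 leaf; nothing credited. [cite: Kim2022StructureSelmer, Thm. 1.9 (6), §1.5.1] [cite: Kim2025RefinedTNC, Thm. 1.2]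
[cite: Miller2011LMS, Def. 1.1] -/
theorem missingLowerBoundAt_wild_of_kimAtThree_of_indexCert (hKim : N11.KimAtThreeRankZeroPUB)
    (hGZK : rank_eq_analyticRank_of_analyticRank_le_one) (hmod : hasEntireLFunction_rat)
    (W : WeierstrassCurve ℚ) [W.IsElliptic] [W.IsGloballyMinimal] [Fact (3 : ℕ).Prime]
    (hr : W.analyticRank = 0) (_hO : ClassO6 W 3)
    (htower : ∀ n : ℕ, W.HasSurjectiveModNGaloisRep (3 ^ n : ℕ))
    (ht0 : Nat.card {Q : (W.baseChange ℚ_[3]).toAffine.Point // (3 : ℕ) • Q = 0} = 1)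
    {N : ℕ} [NeZero N] (D : ModularParametrizationData W N) (hc : ¬ (3 : ℤ) ∣ D.maninConstant)
    (hper : ∃ u : ℚ, ‖(u : ℚ_[3])‖ = 1 ∧ W.realPeriodRat = u * plusPeriod D.f)
    {k n : ℕ} [NeZero n] (hk : 1 ≤ k) (hn : Kato.IsKolyvaginProduct W 3 k n)
    (hcyc : ∀ (ℓ : ℕ) [Fact ℓ.Prime], ℓ ∣ n →
      Nat.card {P : ((WeierstrassCurve.integralModelInt W).map
          (Int.castRingHom (ZMod ℓ))).toAffine.Point // 3 • P = 0} ≤ 3)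
    (ψ : (ℓ : ℕ) → (ZMod ℓ)ˣ →* Multiplicative (ZMod (3 ^ k)))
    (hψ : ∀ ℓ ∈ n.primeFactors, Function.Surjective (ψ ℓ))
    (hδ : kuriharaNumber D.f (3 ^ k) n ψ ≠ 0) (hkt : k - 1 ≤ padicValNat 3 W.tamagawaProduct) :
    MissingLowerBoundAt W 3 := by
  have hsurj : Surj W 3 := by have h := htower 1; rwa [pow_one] at h
  exact N11.missingLowerBoundAt_three_of_kimAtThreeRankZeroPUB_of_indexCert W hKim hGZK hsurj htower ht0
    ((W.analyticRank_eq_zero_iff_holds (hmod W)).mp hr) D hc hper hk hn hcyc ψ hψ hδ hkt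

/-- **The tower-surjective, `t = 0`, `3 ∤ ∏ c_ℓ` rows of `stub_lower_irred` from rung W2's leaf and
KURIHARA'S CONJECTURE on those rows** (displayed as `hKur`: every such curve has an optimal-type datum
with the period transfer and a unit Kurihara number — class-wide this is equivalent to Kato's IMC by
Kim's Conj. 1.3; per pair it is a finite certificate). The remaining irreducible wild rows —
`3`-adic tower NOT onto (mod `3` onto but not mod `9`), `E(ℚ₃)[3] ≠ 0` (Kodaira IV/IV*, `c₃ = 3`), or
`3 ∣ ∏ c_ℓ` without an index certificate — stay with the companion file's KMC / Fouquet–Wan roads. Conditional; nothing credited.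
[cite: Kim2025RefinedTNC, Thm. 1.1/1.2] [cite: Kurihara2014, §1] [cite: Kim2022StructureSelmer, Conj. 1.3] -/
theorem lower_irred_towerSurj_of_kimAtThree_of_kuriharaUnits (hKim : N11.KimAtThreeRankZeroPUB)
    (hGZK : rank_eq_analyticRank_of_analyticRank_le_one) (hmod : hasEntireLFunction_rat)
    (hKur : ∀ (W : WeierstrassCurve ℚ) [W.IsElliptic] [W.IsGloballyMinimal],
      W.analyticRank = 0 → ClassO6 W 3 → (∀ n : ℕ, W.HasSurjectiveModNGaloisRep (3 ^ n : ℕ)) →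
      Nat.card {Q : (W.baseChange ℚ_[3]).toAffine.Point // (3 : ℕ) • Q = 0} = 1 →
      ¬ 3 ∣ W.tamagawaProduct →
        ∃ (N : ℕ) (_ : NeZero N) (D : ModularParametrizationData W N),
          (∃ u : ℚ, ‖(u : ℚ_[3])‖ = 1 ∧ W.realPeriodRat = u * plusPeriod D.f) ∧
            X4.KuriharaUnitAt W 3 D.f) :
    ∀ (W : WeierstrassCurve ℚ) [W.IsElliptic] [W.IsGloballyMinimal] [Fact (3 : ℕ).Prime],
      W.analyticRank = 0 → ClassO6 W 3 → (∀ n : ℕ, W.HasSurjectiveModNGaloisRep (3 ^ n : ℕ)) →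
      Nat.card {Q : (W.baseChange ℚ_[3]).toAffine.Point // (3 : ℕ) • Q = 0} = 1 →
      ¬ 3 ∣ W.tamagawaProduct → MissingLowerBoundAt W 3 := by
  intro W _ _ _ hr hO htower ht0 htam
  obtain ⟨N, hN, D, hper, hKu⟩ := hKur W hr hO htower ht0 htam
  haveI := hN
  exact missingLowerBoundAt_wild_of_kimAtThree_of_kuriharaUnitAt hKim hGZK hmod W hr hO htower ht0 D
    hper htam hKu

/-- **The crux from rung W2's leaf, KURIHARA'S CONJECTURE on the tower-surjective `t = 0`,
`3 ∤ ∏ c_ℓ` wild rank-`0` rows, and the REMAINING rows displayed as one hypothesis** (`hres`: tower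
not onto, or `E(ℚ₃)[3] ≠ 0`, or `3 ∣ ∏ c_ℓ` — there the companion file's KMC / Fouquet–Wan roads and
Cassels reductions are what the tree has). A reshaped composition for the tenure planner; conditional;
the item is NOT closed. [cite: Kim2025RefinedTNC, Thm. 1.1/1.2] [cite: Kurihara2014, §1] [cite: Miller2011LMS, Def. 1.1] -/
theorem wildLowerHalfRankZero_of_kimAtThree_of_kuriharaUnits_of_residualRows
    (hKim : N11.KimAtThreeRankZeroPUB)
    (hGZK : rank_eq_analyticRank_of_analyticRank_le_one) (hmod : hasEntireLFunction_rat)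
    (hKur : ∀ (W : WeierstrassCurve ℚ) [W.IsElliptic] [W.IsGloballyMinimal],
      W.analyticRank = 0 → ClassO6 W 3 → (∀ n : ℕ, W.HasSurjectiveModNGaloisRep (3 ^ n : ℕ)) →
      Nat.card {Q : (W.baseChange ℚ_[3]).toAffine.Point // (3 : ℕ) • Q = 0} = 1 →
      ¬ 3 ∣ W.tamagawaProduct →
        ∃ (N : ℕ) (_ : NeZero N) (D : ModularParametrizationData W N),
          (∃ u : ℚ, ‖(u : ℚ_[3])‖ = 1 ∧ W.realPeriodRat = u * plusPeriod D.f) ∧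
            X4.KuriharaUnitAt W 3 D.f)
    (hres : ∀ (W : WeierstrassCurve ℚ) [W.IsElliptic] [W.IsGloballyMinimal] [Fact (3 : ℕ).Prime],
      W.analyticRank = 0 → ClassO6 W 3 →
      ¬ ((∀ n : ℕ, W.HasSurjectiveModNGaloisRep (3 ^ n : ℕ)) ∧
          Nat.card {Q : (W.baseChange ℚ_[3]).toAffine.Point // (3 : ℕ) • Q = 0} = 1 ∧
          ¬ 3 ∣ W.tamagawaProduct) → MissingLowerBoundAt W 3) :
    WildLowerHalfRankZero := by
  intro W _ _ _ hr hO
  by_cases h : (∀ n : ℕ, W.HasSurjectiveModNGaloisRep (3 ^ n : ℕ)) ∧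
      Nat.card {Q : (W.baseChange ℚ_[3]).toAffine.Point // (3 : ℕ) • Q = 0} = 1 ∧
      ¬ 3 ∣ W.tamagawaProduct
  · exact lower_irred_towerSurj_of_kimAtThree_of_kuriharaUnits hKim hGZK hmod hKur W hr hO h.1 h.2.1
      h.2.2
  · exact hres W hr hO h

end KimKurihara

end Summit.BirchSwinnertonDyer.BirchSwinnertonDyer.Theorems

end
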